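import Literature.Computability.AlgebraicComplexity.QuasiPolynomialFormulasProofs
import Summits.ValiantsHypothesis.ValiantsHypothesis.Theses.DivisionGap
import Summits.ValiantsHypothesis.ValiantsHypothesis.Theorems.DivisionGapShadowCofactorSplit
import Summits.ValiantsHypothesis.ValiantsHypothesis.Theorems.DivisionGapPerMultiplesToDivision

/-!
# `PerDivisionHard` — the FORMULA split of H1 (crux-strategist r1, crux `stmt-ValiantsHypothesis-5065`)

Route `route-ValiantsHypothesis-DivisionGap`, crux `PerDivisionHard` (H1, charged form).  This file
is the sorry-free ASSEMBLY of the typed decomposition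

  `PerFormulaMultiplesHard → PerCofactorDegreeReduction → PerDivisionHard`

(`perDivisionHard_of_formulaSplit`), where

* `PerFormulaMultiplesHard` (NEW piece, written out verbatim below as the first hypothesis; it is
  the statement the route edit files as the split child of the same name): for every `c`, for all
  large `n`, every monotone fan-in-two FORMULA over `ℝ≥0` computing a nonzero multiple `per_n · h`
  has size `> 2^{(log₂ n + c)^c}` — the formula-strength form of HrubesYehudayoff2021 §6 Problem 2
  for the permanent ("super-polynomial lower bounds for monotone formulas WITH DIVISION are known
  only through the shadow complexity `σ(Newt f)`", Thm. 42/44; for `per_n` this needs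
  `σ(DS_n)` large = Open Problem 1 = the route's `ShadowBirkhoff`).  `h` is NOT charged and its
  degree is automatically at most the formula size.
* `PerCofactorDegreeReduction` is the EXISTING crux `stmt-ValiantsHypothesis-15046` (degree
  reduction for cheap monotone multiples of `per_n`).

Position of the new piece (all sorry-free here):
* `perFormulaMultiplesHard_of_perMultiplesHard` — it is implied by the uncharged crux
  `PerMultiplesHard` (`L ≤ E`, `complexity_le_formulaComplexity_holds`);
* `perFormulaMultiplesHard_of_shadowBirkhoff` — it is implied by the crux `ShadowBirkhoff`
  (HY21 Thm. 42 for the tree's formula model, landed as `ncard_extremePoints_le_of_multiple`), so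
  it is WEAKER than both existing H1 engines and is their common meeting point;
* `perMultiplesHard_of_formulaSplit` — with degree reduction it gives back `PerMultiplesHard`
  (balancing: `formulaComplexity_le_two_pow`, BCS 1997 (21.35)/(21.36) over the commutative
  semiring `ℝ≥0`, hence monotone; exponent bookkeeping `exists_exponent`), and
* `perDivisionHard_of_formulaSplit` — hence the charged crux `PerDivisionHard`
  (`perMultiplesToDivision_proof`).

So on the ledger `{PerFormulaMultiplesHard, PerCofactorDegreeReduction} ⇒ PerDivisionHard`, the
existing glue `ShadowCofactorSplit` factors as `ShadowBirkhoff ⇒ PerFormulaMultiplesHard` followed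
by this file, and the formula piece can be attacked either through shadows (`ShadowBirkhoff`) or by
a `per`-specific monotone-formula argument (the lead's K2F chapter `stub_formulaRigid`), without
committing the route to `σ(DS_n)` being large.

## References

* P. Hrubeš, A. Yehudayoff, *Shadows of Newton polytopes*, CCC 2021, LIPIcs 200:9, §6 Problem 2,
  Thm. 42, Thm. 44, Open Problems 1–3 [HrubesYehudayoff2021].
* P. Bürgisser, M. Clausen, M. A. Shokrollahi, *Algebraic Complexity Theory*, Springer 1997,
  Thm. (21.35) (Brent), Thm. (21.36) (Hyafil, Valiant–Skyum–Berkowitz–Rackoff)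
  [BurgisserClausenShokrollahi1997].
-/

noncomputable section

-- `Summit.ValiantsHypothesis.ValiantsHypothesis.…` is the tree's single-conjunct layout (Sub = Summit).
set_option linter.dupNamespace false

namespace Summit.ValiantsHypothesis.ValiantsHypothesis.Theorems.DivisionGap.FormulaSplit

open scoped NNReal
open MvPolynomial
open Literature.Computability.AlgebraicComplexity
open Summit.ValiantsHypothesis.ValiantsHypothesis.Theses.DivisionGap
open Summit.ValiantsHypothesis.ValiantsHypothesis.Theorems.DivisionGap.ShadowCofactorSplit
  (ncard_extremePoints_le_of_multiple exists_exponent)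

/-- **The uncharged crux implies the formula piece**: `PerMultiplesHard →
PerFormulaMultiplesHard`, because a fan-in-two formula is a circuit (`L(f) ≤ E(f)`,
`complexity_le_formulaComplexity_holds`). [folklore] -/
theorem perFormulaMultiplesHard_of_perMultiplesHard (H : PerMultiplesHard) :
    ∀ c : ℕ, ∃ n₀ : ℕ, ∀ n ≥ n₀, ∀ h : MvPolynomial (Fin n × Fin n) ℝ≥0, h ≠ 0 →
      2 ^ ((Nat.log 2 n + c) ^ c) < formulaComplexity (perPoly (Fin n) ℝ≥0 * h) := by
  intro c
  obtain ⟨n₀, hn₀⟩ := H c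
  refine ⟨n₀, fun n hn h hh => ?_⟩
  exact lt_of_lt_of_le (hn₀ n hn h hh) (complexity_le_formulaComplexity_holds _)

/-- **The shadow crux implies the formula piece**: `ShadowBirkhoff → PerFormulaMultiplesHard`.
If for some `c` there were arbitrarily large `n` and `h ≠ 0` with a monotone formula for
`per_n · h` of size `≤ 2^{(log₂ n + c)^c}`, then EVERY shadow of `DS_n` would have at most
`4(3 · 2^{(log₂ n + c)^c} + 1) ≤ 2^{(log₂ n + c)^c + 4} ≤ 2^{(log₂ n + (c+4))^{c+4}}` vertices
(`ncard_extremePoints_le_of_multiple` = HrubesYehudayoff2021 Thm. 42 for the tree's formula model),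
contradicting `ShadowBirkhoff` at exponent `c + 4`.
[cite: HrubesYehudayoff2021, Thm. 42 (= Thm. 1 with Lemma 12)] -/
theorem perFormulaMultiplesHard_of_shadowBirkhoff (H : ShadowBirkhoff) :
    ∀ c : ℕ, ∃ n₀ : ℕ, ∀ n ≥ n₀, ∀ h : MvPolynomial (Fin n × Fin n) ℝ≥0, h ≠ 0 →
      2 ^ ((Nat.log 2 n + c) ^ c) < formulaComplexity (perPoly (Fin n) ℝ≥0 * h) := by
  intro c
  obtain ⟨n₀, hn₀⟩ := H (c + 4)
  refine ⟨n₀, fun n hn h hh => ?_⟩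
  by_contra hs
  push Not at hs
  obtain ⟨L, hL⟩ := hn₀ n hn
  set ℓ := Nat.log 2 n with hℓ
  set A := (ℓ + c) ^ c with hA
  have hfinal : (Set.extremePoints ℝ (convexHull ℝ (L '' permMatrixPoints n))).ncard ≤
      2 ^ ((ℓ + (c + 4)) ^ (c + 4)) := by
    have hV := ncard_extremePoints_le_of_multiple L h hh
    have h1 : 4 * (3 * formulaComplexity (perPoly (Fin n) ℝ≥0 * h) + 1) ≤ 4 * (3 * 2 ^ A + 1) :=
      Nat.mul_le_mul_left 4 (Nat.add_le_add_right (Nat.mul_le_mul_left 3 hs) 1)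
    have h2 : 4 * (3 * 2 ^ A + 1) ≤ 2 ^ (A + 4) := by
      rw [pow_add]
      have h16 : (2 : ℕ) ^ 4 = 16 := by norm_num
      rw [h16]
      have := Nat.one_le_two_pow (n := A)
      omega
    -- `A + 4 ≤ (ℓ + c + 4)^(c+4)` via `(ℓ+c+4)^(c+4) = (ℓ+c+4)^c · (ℓ+c+4)^4 ≥ A · 16`.
    have hpow : A + 4 ≤ (ℓ + (c + 4)) ^ (c + 4) := by
      have hsplit : (ℓ + (c + 4)) ^ (c + 4) = (ℓ + (c + 4)) ^ c * (ℓ + (c + 4)) ^ 4 := by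
        rw [← pow_add]
      have hc4 : 16 ≤ (ℓ + (c + 4)) ^ 4 :=
        calc 16 = 2 ^ 4 := by norm_num
          _ ≤ (ℓ + (c + 4)) ^ 4 := Nat.pow_le_pow_left (by omega) 4
      have hAc : A ≤ (ℓ + (c + 4)) ^ c := by
        rw [hA]; exact Nat.pow_le_pow_left (by omega) c
      have hA1 : 1 ≤ (ℓ + (c + 4)) ^ c := Nat.one_le_pow _ _ (by omega)
      rw [hsplit]
      nlinarith
    exact hV.trans (h1.trans (h2.trans (Nat.pow_le_pow_right Nat.two_pos hpow)))
  exact absurd hL (not_lt.2 hfinal)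

/-- **The formula split, uncharged conclusion**:
`PerFormulaMultiplesHard → PerCofactorDegreeReduction → PerMultiplesHard`.
Suppose `PerMultiplesHard` fails: some `c` and arbitrarily large `n` carry `h ≠ 0` with
`s = L₊(per_n · h) ≤ 2^{(log₂ n + c)^c}`.  Degree reduction (exponent `k`) gives `h' ≠ 0` with
`deg h' ≤ 2^{E₁}` and `L₊(per_n · h') ≤ 2^{E₁}`, `E₁ ≤ E₂ = (log₂ n + (log₂ n + c)^c + k)^k`; with
`E = E₂ + 2 log₂ n + 3` the balancing theorem `formulaComplexity_le_two_pow`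
(Brent/Hyafil/VSBR over the commutative semiring `ℝ≥0`, hence monotone) gives a monotone FORMULA
for `per_n · h'` of size `≤ 2^{18E²} ≤ 2^{(log₂ n + c₂)^{c₂}}` (`exists_exponent`), contradicting
the formula piece at exponent `c₂` for `n ≥ n₀(c₂)`.
[cite: BurgisserClausenShokrollahi1997, Thm. (21.35)/(21.36); HrubesYehudayoff2021, §6 Problem 2] -/
theorem perMultiplesHard_of_formulaSplit
    (hF : ∀ c : ℕ, ∃ n₀ : ℕ, ∀ n ≥ n₀, ∀ h : MvPolynomial (Fin n × Fin n) ℝ≥0, h ≠ 0 →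
      2 ^ ((Nat.log 2 n + c) ^ c) < formulaComplexity (perPoly (Fin n) ℝ≥0 * h))
    (hDR : PerCofactorDegreeReduction) : PerMultiplesHard := by
  unfold PerCofactorDegreeReduction at hDR
  unfold PerMultiplesHard
  by_contra hPMH
  push Not at hPMH
  obtain ⟨c, hc⟩ := hPMH
  obtain ⟨k, hk⟩ := hDR
  obtain ⟨c₂, hc₂⟩ := exists_exponent c k
  obtain ⟨n₀, hn₀⟩ := hF c₂
  obtain ⟨n, hn, h, hh, hs⟩ := hc n₀
  obtain ⟨h', hh', hdeg, hcomp⟩ := hk n h hh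
  -- abbreviations
  set s := complexity (perPoly (Fin n) ℝ≥0 * h) with hs_def
  set ℓ := Nat.log 2 n with hℓ
  set A := (ℓ + c) ^ c with hA
  have hlog : Nat.log 2 s ≤ A :=
    calc Nat.log 2 s ≤ Nat.log 2 (2 ^ A) := Nat.log_mono_right hs
      _ = A := Nat.log_pow Nat.one_lt_two A
  set E₁ := (ℓ + Nat.log 2 s + k) ^ k with hE₁
  set E₂ := (ℓ + A + k) ^ k with hE₂
  have hE₁₂ : E₁ ≤ E₂ := Nat.pow_le_pow_left (by omega) k
  set E := E₂ + 2 * ℓ + 3 with hE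
  -- the hypotheses of the balancing theorem
  have h2E : 2 ^ E = 2 ^ E₂ * 2 ^ (ℓ + 1) * 2 ^ (ℓ + 1) * 2 := by
    rw [hE, show E₂ + 2 * ℓ + 3 = E₂ + (ℓ + 1) + (ℓ + 1) + 1 by omega, pow_add, pow_add, pow_add,
      pow_one]
  have hnlt : n < 2 ^ (ℓ + 1) := Nat.lt_pow_succ_log_self Nat.one_lt_two n
  have ha1 : 1 ≤ 2 ^ E₂ := Nat.one_le_two_pow
  have hb1 : 1 ≤ 2 ^ (ℓ + 1) := Nat.one_le_two_pow
  have hd : n + 2 ^ E₂ < 2 ^ E := by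
    rw [h2E]
    have h1 : n + 2 ^ E₂ < 2 ^ (ℓ + 1) + 2 ^ E₂ := by omega
    have h2 : 2 ^ (ℓ + 1) ≤ 2 ^ E₂ * 2 ^ (ℓ + 1) * 2 ^ (ℓ + 1) :=
      calc 2 ^ (ℓ + 1) = 1 * 2 ^ (ℓ + 1) * 1 := by ring
        _ ≤ 2 ^ E₂ * 2 ^ (ℓ + 1) * 2 ^ (ℓ + 1) :=
          Nat.mul_le_mul (Nat.mul_le_mul_right _ ha1) hb1
    have h3 : 2 ^ E₂ ≤ 2 ^ E₂ * 2 ^ (ℓ + 1) * 2 ^ (ℓ + 1) :=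
      calc 2 ^ E₂ = 2 ^ E₂ * 1 * 1 := by ring
        _ ≤ 2 ^ E₂ * 2 ^ (ℓ + 1) * 2 ^ (ℓ + 1) :=
          Nat.mul_le_mul (Nat.mul_le_mul_left _ hb1) hb1
    omega
  have hcard : Fintype.card (Fin n × Fin n) ≤ 2 ^ E := by
    rw [Fintype.card_prod, Fintype.card_fin, h2E]
    calc n * n ≤ 2 ^ (ℓ + 1) * 2 ^ (ℓ + 1) := Nat.mul_le_mul hnlt.le hnlt.le
      _ = 1 * 2 ^ (ℓ + 1) * 2 ^ (ℓ + 1) * 1 := by ring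
      _ ≤ 2 ^ E₂ * 2 ^ (ℓ + 1) * 2 ^ (ℓ + 1) * 2 :=
          Nat.mul_le_mul (Nat.mul_le_mul_right _ (Nat.mul_le_mul_right _ ha1)) (by norm_num)
  have hper : (perPoly (Fin n) ℝ≥0).totalDegree ≤ n := by
    simpa using (perPoly_isHomogeneous (n := Fin n) (k := ℝ≥0)).totalDegree_le
  have hdeg' : (perPoly (Fin n) ℝ≥0 * h').totalDegree ≤ n + 2 ^ E₂ :=
    calc (perPoly (Fin n) ℝ≥0 * h').totalDegree
        ≤ (perPoly (Fin n) ℝ≥0).totalDegree + h'.totalDegree := totalDegree_mul _ _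
      _ ≤ n + 2 ^ E₁ := add_le_add hper hdeg
      _ ≤ n + 2 ^ E₂ := Nat.add_le_add_left (Nat.pow_le_pow_right Nat.two_pos hE₁₂) n
  have hL' : complexity (perPoly (Fin n) ℝ≥0 * h') ≤ 2 ^ E :=
    hcomp.trans ((Nat.pow_le_pow_right Nat.two_pos hE₁₂).trans
      (Nat.pow_le_pow_right Nat.two_pos (by omega)))
  have hE1 : 1 ≤ E := by omega
  have hfc := formulaComplexity_le_two_pow hdeg' hd hcard hL' hE1
  -- the formula piece at exponent `c₂`
  have hlt := hn₀ n hn h' hh'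
  have hexp : 18 * E ^ 2 + 4 ≤ (ℓ + c₂) ^ c₂ := by
    have := hc₂ ℓ
    rw [hE, hE₂, hA]
    exact this
  have hfinal : formulaComplexity (perPoly (Fin n) ℝ≥0 * h') ≤ 2 ^ ((ℓ + c₂) ^ c₂) :=
    hfc.trans (Nat.pow_le_pow_right Nat.two_pos (by omega))
  exact absurd hlt (not_lt.2 hfinal)

/-- **The formula split of the crux (assembly of the decomposition, sorry-free):**
`PerFormulaMultiplesHard → PerCofactorDegreeReduction → PerDivisionHard`, through
`perMultiplesHard_of_formulaSplit` and the proved support `PerMultiplesToDivision`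
(`perMultiplesToDivision_proof`: `L₊(per_n·h) ≤ L₊(per_n·h) + L₊(h)`).
[cite: HrubesYehudayoff2021, §6 Problem 2; BurgisserClausenShokrollahi1997, Thm. (21.35)/(21.36)] -/
theorem perDivisionHard_of_formulaSplit : (∀ c : ℕ, ∃ n₀ : ℕ, ∀ n ≥ n₀, ∀ h : MvPolynomial (Fin n × Fin n) ℝ≥0, h ≠ 0 → 2 ^ ((Nat.log 2 n + c) ^ c) < formulaComplexity (perPoly (Fin n) ℝ≥0 * h)) → PerCofactorDegreeReduction → PerDivisionHard :=
  fun hF hDR =>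
    Summit.ValiantsHypothesis.ValiantsHypothesis.Theorems.perMultiplesToDivision_proof
      (perMultiplesHard_of_formulaSplit hF hDR)

end Summit.ValiantsHypothesis.ValiantsHypothesis.Theorems.DivisionGap.FormulaSplit

end
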